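import Summits.QuantumFields.BalabanUV.Beta.FP.PerfectSymbolAlias

/-!
# `BalabanUV.Beta.FP.PerfectSymbol166` — road «FP» (binder row D1), leaf N0b-K-closed, PART 2: THE CONTINUUM (1.66) MULTIPLIER IN CLOSED
# FORM — `T4Rate166StripDirect.W166lim` IS the `ℤ^d` ALIAS SERIES (Tannery over the growing alias set), on the whole zero-free strip

Road FP (owner b2b-balaban-beta-d1-p3, gen 2; `REP-DESIGN.md` v1.4 (L1)/(L5), `LEAVES-FP.md` row N0b-K-closed).  Bałaban's k-th step multiplier
`W^{(n)}_{μν}(p′)` of [Balaban1984PropagatorsI] (1.66) p. 29 (tree: `B5Symbol166.W166 n μ ν p = Π_{λ∉{μ,ν}} Y_λ/F`, `Y_λ = c_λ + Δ·R̃_λ`, `R̃_λ = Σ_{k≠0} T_k`, alias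
indices `k : Fin d → Fin n`) converges at King's rate to `T4Rate166StripDirect.W166lim := limUnder …` (t4-ne2 lineage); gan24-p3's perfect Laplacian `Δ_∞ =
EffectiveLaplacianLimit.deltaZLim` is built on it.  THIS FILE NAMES THE LIMIT IN CLOSED FORM:
* §1 the continuum objects: alias term `TInf λ l p := U_∞(l;p)·u_∞(l_λ;p_λ)/Σ_ν(p_ν+2πl_ν)²`, `RtInf λ p := Σ'_{l ∈ ℤ^d∖0} TInf λ l p`, `cfacInf`, `D0Inf p := Σ_ν p_ν²`,
  `YcInf := cfacInf + D0Inf·RtInf`, `F66Inf`, **`W166Inf μ ν p := Π_{λ∉{μ,ν}} YcInf λ p / F66Inf p`** (the printed algebra of `B5Symbol166` with every level-`n`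
  symbol replaced by its `n = ∞` limit).
* §2 termwise limits on the fat box (`tendsto_cfac`, `tendsto_DeltaXi0`, `tendsto_T166_repK`; the alias denominators stay away from `0`: `re_SqInf_ge`).
* §3 **`tendsto_Rt`**: `R̃^{(n)}_λ(p) → RtInf λ p` — the alias sum over `Fin d → Fin n` re-indexed by the centred box of `ℤ^d` (PART 1 `sum_fin_eq_sum_boxK`) and
  TANNERY's theorem (`tendsto_tsum_of_dominated_convergence`) with PART 1's `n`-free summable majorant `(64·64/7)·maj`.
* §4 assembly `tendsto_Yc`, `tendsto_F66`, `tendsto_W166` (denominator: `B5Symbol166Strip.F66_lower` ⇒ `‖F66Inf‖ ≥ c₀ > 0`), and the identification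
  **`W166lim_eq_W166Inf`**: on the zero-free strip `Strip d κ`, `0 ≤ κ ≤ κ₁₆₆(d)`, `W166lim μ ν p = W166Inf μ ν p` (uniqueness of limits).
So the perfect objects downstream (`GsymLim`, `deltaZLim`, the mm block of `KPerf … m` via `FP/PerfectSymbolKMultiplier`) have an EXPLICIT alias-series symbol.
ORIENTATION (not used, not cited as fact): `YcInf λ p / D0Inf p = Σ_{l∈ℤ^d} Π_ν(2sin(p_ν/2)/(p_ν+2πl_ν))²·(2sin(p_λ/2)/(p_λ+2πl_λ))²/|p+2πl|²` is the shape of the perfect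
free-gluon action's `Δ^g_λ(p)` at `α = γ = 0` in W. Bietenholz, U.-J. Wiese, Nucl. Phys. B 464 (1996) 319, (3.13)/(3.16); road FP's GERM-K reads the small-`p` germ off this form.
[our object]/[folklore]: elementary analysis over tree theorems BY NAME; 0 `def … : Prop`; nothing about Bałaban's theorems asserted; nothing cited.
HONEST FRAMING: bookkeeping/analysis toward the explicit perfect objects of road FP (`hident`, GAPS O-asym1-7); discharges nothing of `BetaPertH`; NOT the continuum
limit, NOT Clay.  HONEST DEPENDENCY (verbatim): «continuum YM on T⁴ ⇐ BetaPertH ∧ nine spine estimates (0/9 proved); BetaPertH ⇐ (D1) ∧ (D4) ∧ CAP+tail;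
G-an2-4 gates asym, D1 and NE2/3/4.»
-/

noncomputable section

namespace Summit.QuantumFields.BalabanUV.Beta.FP.PerfectSymbol166

open Filter Topology Finset
open scoped BigOperators
open Literature.MathematicalPhysics.QuantumFieldTheory.Balaban1983to89
open B4Strip (S1 Sxi DeltaXi shift uFactor U Strip)
open B4StripCauchy (Fat strip_subset_fat rOf rOf_pos rOf_le d_mul_rOf_sq_le)
open B4StripSums (W one_le_W re_DeltaXi_shift_ge_W)
open B5Symbol166 (cfac Rt Yc F66 W166)
open B5Symbol166Strip (kappa166 kappa166_le_rOf F66_lower)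
open T4Rate166StripDirect (T166 Rt_eq_sum cω cω_pos norm_T166_le W166lim tendsto_W166lim fat_re)
open Summit.QuantumFields.BalabanUV.Beta.FP.PerfectSymbolAlias

variable {d : ℕ}

/-! ## §1 The continuum objects (closed form) -/

/-- [our object] the continuum alias term `T_∞(λ; l; p) := U_∞(l;p)·u_∞(l_λ;p_λ)/Σ_ν(p_ν+2πl_ν)²`. -/
def TInf (lam : Fin d) (l : Fin d → ℤ) (p : Fin d → ℂ) : ℂ := UInf l p * uInf (l lam) (p lam) / SqInf l p

/-- [our object] the continuum alias remainder `R̃_∞(λ; p) := Σ'_{l ≠ 0} T_∞(λ; l; p)` (series over `ℤ^d`). -/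
def RtInf (lam : Fin d) (p : Fin d → ℂ) : ℂ := ∑' l : Fin d → ℤ, if l = 0 then 0 else TInf lam l p

/-- [our object] the continuum `l = 0` factor `c_∞(λ; p) := U_∞(0;p)·u_∞(0;p_λ)`. -/
def cfacInf (lam : Fin d) (p : Fin d → ℂ) : ℂ := UInf 0 p * uInf 0 (p lam)

/-- [our object] the continuum Laplacian symbol `Σ_ν p_ν²`. -/
def D0Inf (p : Fin d → ℂ) : ℂ := ∑ ν, p ν ^ 2

/-- [our object] `Y_∞(λ; p) := c_∞ + (Σ_ν p_ν²)·R̃_∞` (= `p²·φ_λ^∞(p)`, `φ^∞` the full alias series). -/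
def YcInf (lam : Fin d) (p : Fin d → ℂ) : ℂ := cfacInf lam p + D0Inf p * RtInf lam p

/-- [our object] the continuum regrouped denominator `F_∞` (the algebra of `B5Symbol166.F66` at `n = ∞`). -/
def F66Inf (p : Fin d → ℂ) : ℂ :=
  UInf 0 p ^ d + ∑ lam, S1 (p lam) * ∑ T ∈ ((univ.erase lam).powerset).erase ∅,
    D0Inf p ^ (T.card - 1) * ((∏ lam' ∈ T, RtInf lam' p) * ∏ lam' ∈ (univ.erase lam) \ T, cfacInf lam' p)

/-- [our object] **THE CONTINUUM (1.66) MULTIPLIER IN CLOSED FORM**: `W_∞(μ,ν; p) := Π_{λ∉{μ,ν}} Y_∞(λ;p) / F_∞(p)`. -/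
def W166Inf (μ ν : Fin d) (p : Fin d → ℂ) : ℂ := (∏ lam ∈ (univ.erase μ).erase ν, YcInf lam p) / F66Inf p

/-! ## §2 Termwise limits on the fat box -/

/-- the representative vector of `0` is `0`. [folklore] -/
theorem repK_zero (N : ℕ) [NeZero N] : repK N (0 : Fin d → ℤ) = fun _ => (0 : Fin N) := by
  funext ν; apply Fin.ext
  have := (repFin_eq_zero_iff N (l := 0) (by simp [Nat.pos_of_ne_zero (NeZero.ne N)])
    (by exact_mod_cast Nat.pos_of_ne_zero (NeZero.ne N))).mpr rfl
  simpa [repK] using this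

/-- `U` at the zero residue as `U` at the representative of `0`. [folklore] -/
theorem U_zero_eq_repK (N : ℕ) [NeZero N] (q : Fin d → ℂ) : U N (fun _ => (0 : Fin N)) q = U N (repK N 0) q := by
  rw [repK_zero]

section Termwise

variable {r : ℝ} (hr : r ≤ 1 / 4) {p : Fin d → ℂ} (hp : p ∈ Fat d r)
include hr hp

/-- on the fat box every shifted coordinate `p_ν + 2πl` is non-zero unless `(l, p_ν) = (0, 0)`. [folklore] -/
theorem alias_ne_zero_or (ν : Fin d) (l : ℤ) : p ν + 2 * Real.pi * (l : ℂ) ≠ 0 ∨ (l = 0 ∧ p ν = 0) := by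
  by_cases hl : l = 0
  · subst hl
    by_cases h0 : p ν = 0
    · exact Or.inr ⟨rfl, h0⟩
    · left; simpa using h0
  · left
    intro h
    have hre := congrArg Complex.re h
    simp only [Complex.add_re, Complex.mul_re, Complex.re_ofNat, Complex.ofReal_re, Complex.im_ofNat,
      Complex.ofReal_im, mul_zero, sub_zero, Complex.intCast_re, Complex.intCast_im, Complex.zero_re] at hre
    have hx := abs_le.mp (fat_re hr hp ν)
    have hπ := Real.pi_gt_three
    rcases lt_or_gt_of_ne hl with hl' | hl'
    · have : (l : ℝ) ≤ -1 := by exact_mod_cast (show l ≤ -1 by omega)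
      nlinarith
    · have : (1 : ℝ) ≤ l := by exact_mod_cast (show 1 ≤ l by omega)
      nlinarith

/-- `c^{(n)}_λ(p) → c_∞(λ;p)`. [folklore] -/
theorem tendsto_cfac (lam : Fin d) : Tendsto (fun j : ℕ => cfac (j + 1) lam p) atTop (𝓝 (cfacInf lam p)) := by
  unfold cfac cfacInf
  have hU := tendsto_U_repK (0 : Fin d → ℤ) p (fun ν => alias_ne_zero_or hr hp ν 0)
  have hu := tendsto_uFactor_repFin 0 (p lam) (alias_ne_zero_or hr hp lam 0)
  have hrep : ∀ j : ℕ, (repFin (j + 1) 0 : ℕ) = 0 := fun j =>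
    (repFin_eq_zero_iff (j + 1) (by push_cast; linarith) (by push_cast; linarith)).mpr rfl
  simp only [hrep] at hu
  refine (Tendsto.congr (fun j => ?_) hU).mul hu
  rw [U_zero_eq_repK]

omit hr hp in
/-- `(Δ^ξ)^{(n)}(p) → Σ_ν p_ν²`. [folklore] -/
theorem tendsto_DeltaXi0 : Tendsto (fun j : ℕ => DeltaXi (j + 1) 0 p) atTop (𝓝 (D0Inf p)) := by
  have h := tendsto_DeltaXi_shift_repK (0 : Fin d → ℤ) p
  have e : SqInf (0 : Fin d → ℤ) p = D0Inf p := by simp [SqInf, D0Inf]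
  rw [← e]
  refine h.congr fun j => ?_
  rw [repK_zero]; unfold shift; simp

/-- the continuum alias denominator has real part `≥ 7/64` for `l ≠ 0` (limit of `B4StripSums.re_DeltaXi_shift_ge_W`; needs `d r² ≤ 1/16`). [folklore] -/
theorem re_SqInf_ge (hdr : (d : ℝ) * r ^ 2 ≤ 1 / 16) {l : Fin d → ℤ} (hl : l ≠ 0) : 7 / 64 ≤ (SqInf l p).re := by
  have ht := (Complex.continuous_re.tendsto _).comp (tendsto_DeltaXi_shift_repK l p)
  refine ge_of_tendsto ht ?_
  filter_upwards [eventually_mem_boxK l] with j hj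
  have hk : repK (j + 1) l ≠ fun _ => 0 := fun h => hl ((repK_eq_zero_iff (j + 1) hj).mp h)
  have h := re_DeltaXi_shift_ge_W (j + 1) 0 le_rfl hr hdr hp (repK (j + 1) l) hk
  have hW := one_le_W (j + 1) (repK (j + 1) l) hk
  exact le_trans (by linarith) h

/-- `Σ_ν (p_ν+2πl_ν)² ≠ 0` for `l ≠ 0` on the fat box. [folklore] -/
theorem SqInf_ne_zero (hdr : (d : ℝ) * r ^ 2 ≤ 1 / 16) {l : Fin d → ℤ} (hl : l ≠ 0) : SqInf l p ≠ 0 := by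
  intro h
  have := re_SqInf_ge hr hp hdr hl
  rw [h, Complex.zero_re] at this
  linarith

/-- **termwise limit of the alias summand**: `T^{(n)}(λ; rep l; p) → T_∞(λ; l; p)` for `l ≠ 0`. [folklore] -/
theorem tendsto_T166_repK (hdr : (d : ℝ) * r ^ 2 ≤ 1 / 16) (lam : Fin d) {l : Fin d → ℤ} (hl : l ≠ 0) :
    Tendsto (fun j : ℕ => T166 (j + 1) lam (repK (j + 1) l) p) atTop (𝓝 (TInf lam l p)) := by
  unfold T166 TInf
  have hU := tendsto_U_repK l p (fun ν => alias_ne_zero_or hr hp ν (l ν))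
  have hu := tendsto_uFactor_repFin (l lam) (p lam) (alias_ne_zero_or hr hp lam (l lam))
  have hD := tendsto_DeltaXi_shift_repK l p
  exact (hU.mul hu).div hD (SqInf_ne_zero hr hp hdr hl)

end Termwise

/-! ## §3 Tannery: the alias remainder converges to the `ℤ^d` series -/

section Tannery

variable {r : ℝ} (hr : r ≤ 1 / 4) (hdr : (d : ℝ) * r ^ 2 ≤ 1 / 16) {p : Fin d → ℂ} (hp : p ∈ Fat d r)

/-- the alias remainder of level `N` as a finitely supported series over `ℤ^d` (centred box, `l ≠ 0`). [folklore] -/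
theorem Rt_eq_tsum (N : ℕ) [NeZero N] (lam : Fin d) (q : Fin d → ℂ) :
    Rt N lam q = ∑' l : Fin d → ℤ, (if l ∈ boxK d N ∧ l ≠ 0 then T166 N lam (repK N l) q else 0) := by
  classical
  rw [Rt_eq_sum]
  have h1 : ∑ k ∈ univ.erase (fun _ => (0 : Fin N)), T166 N lam k q
      = ∑ k : Fin d → Fin N, (if k = (fun _ => (0 : Fin N)) then 0 else T166 N lam k q) := by
    rw [← Finset.sum_erase_add _ _ (Finset.mem_univ (fun _ => (0 : Fin N))), if_pos rfl, add_zero]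
    exact Finset.sum_congr rfl fun k hk => by rw [if_neg (Finset.ne_of_mem_erase hk)]
  rw [h1, sum_fin_eq_sum_boxK]
  rw [tsum_eq_sum (s := boxK d N) (fun l hl => by rw [if_neg (fun h => hl h.1)])]
  refine Finset.sum_congr rfl fun l hl => ?_
  by_cases h0 : l = 0
  · rw [if_pos ((repK_eq_zero_iff N hl).mpr h0), if_neg (fun h => h.2 h0)]
  · rw [if_neg (fun h => h0 ((repK_eq_zero_iff N hl).mp h)), if_pos ⟨hl, h0⟩]

include hr hdr hp in
/-- the `n`-free domination of the alias summands at representatives: `‖T^{(N)}(λ; rep l; p)‖ ≤ (64·64/7)·maj l` on the centred box. [folklore] -/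
theorem norm_T166_repK_le (N : ℕ) [NeZero N] (lam : Fin d) {l : Fin d → ℤ} (hl : l ∈ boxK d N) (hl0 : l ≠ 0) :
    ‖T166 N lam (repK N l) p‖ ≤ 64 * (64 / 7) * maj l := by
  have hk : repK N l ≠ fun _ => 0 := fun h => hl0 ((repK_eq_zero_iff N hl).mp h)
  have h := norm_T166_le N hr hdr hp hk lam
  have hW := one_le_W N (repK N l) hk
  have hc := cω_repK_le_maj N (mem_boxK.mp hl)
  have hc0 := (cω_pos (repK N l)).le
  have h1 : 64 / 7 / W N (repK N l) ≤ 64 / 7 := div_le_self (by norm_num) hW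
  calc ‖T166 N lam (repK N l) p‖ ≤ cω N (repK N l) * 64 * (64 / 7 / W N (repK N l)) := h
    _ ≤ maj l * 64 * (64 / 7) :=
        mul_le_mul (mul_le_mul_of_nonneg_right hc (by norm_num)) h1 (div_nonneg (by norm_num) (by linarith))
          (mul_nonneg (maj_nonneg l) (by norm_num))
    _ = 64 * (64 / 7) * maj l := by ring

include hr hdr hp in
/-- **TANNERY FOR THE ALIAS REMAINDER**: `R̃^{(n)}_λ(p) → R̃_∞(λ; p) = Σ'_{l ≠ 0} T_∞(λ; l; p)` on the fat box. [folklore] -/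
theorem tendsto_Rt (lam : Fin d) : Tendsto (fun j : ℕ => Rt (j + 1) lam p) atTop (𝓝 (RtInf lam p)) := by
  classical
  have e : (fun j : ℕ => Rt (j + 1) lam p)
      = fun j : ℕ => ∑' l : Fin d → ℤ, (if l ∈ boxK d (j + 1) ∧ l ≠ 0 then T166 (j + 1) lam (repK (j + 1) l) p else 0) := by
    funext j; exact Rt_eq_tsum (j + 1) lam p
  rw [e]
  unfold RtInf
  refine tendsto_tsum_of_dominated_convergence (bound := fun l => if l = 0 then 0 else 64 * (64 / 7) * maj l) ?_ ?_ ?_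
  · have hs := (summable_maj (d := d)).mul_left (64 * (64 / 7))
    refine hs.of_nonneg_of_le (fun l => ?_) (fun l => ?_)
    · split_ifs
      · exact le_rfl
      · have := maj_nonneg l; positivity
    · split_ifs
      · have := maj_nonneg l; positivity
      · exact le_rfl
  · intro l
    by_cases h0 : l = 0
    · simp only [h0, ne_eq, not_true_eq_false, and_false, if_false, if_true]
      exact tendsto_const_nhds
    · simp only [h0, if_false]
      refine (tendsto_T166_repK hr hp hdr lam h0).congr' ?_
      filter_upwards [eventually_mem_boxK l] with j hj
      rw [if_pos ⟨hj, h0⟩]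
  · refine Eventually.of_forall fun j l => ?_
    by_cases h0 : l = 0
    · simp [h0]
    · by_cases hl : l ∈ boxK d (j + 1)
      · rw [if_pos ⟨hl, h0⟩, if_neg h0]
        exact norm_T166_repK_le hr hdr hp (j + 1) lam hl h0
      · rw [if_neg (fun h => hl h.1), if_neg h0, norm_zero]
        have := maj_nonneg l; positivity

end Tannery

/-! ## §4 Assembly and the identification of the constructed limit -/

section Assembly

variable {r : ℝ} (hr : r ≤ 1 / 4) (hdr : (d : ℝ) * r ^ 2 ≤ 1 / 16) {p : Fin d → ℂ} (hp : p ∈ Fat d r)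
include hr hdr hp

/-- `Y^{(n)}_λ(p) → Y_∞(λ; p)`. [folklore] -/
theorem tendsto_Yc (lam : Fin d) : Tendsto (fun j : ℕ => Yc (j + 1) lam p) atTop (𝓝 (YcInf lam p)) := by
  unfold Yc YcInf
  exact (tendsto_cfac hr hp lam).add ((tendsto_DeltaXi0 (p := p)).mul (tendsto_Rt hr hdr hp lam))

/-- `F^{(n)}(p) → F_∞(p)`. [folklore] -/
theorem tendsto_F66 : Tendsto (fun j : ℕ => F66 (j + 1) p) atTop (𝓝 (F66Inf p)) := by
  unfold F66 F66Inf
  have hU0 : Tendsto (fun j : ℕ => U (j + 1) (fun _ => (0 : Fin (j + 1))) p) atTop (𝓝 (UInf 0 p)) := by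
    have hU := tendsto_U_repK (0 : Fin d → ℤ) p (fun ν => alias_ne_zero_or hr hp ν 0)
    exact hU.congr fun j => by rw [U_zero_eq_repK]
  refine (hU0.pow d).add (tendsto_finsetSum _ fun lam _ => ?_)
  refine tendsto_const_nhds.mul (tendsto_finsetSum _ fun T _ => ?_)
  refine ((tendsto_DeltaXi0 (p := p)).pow _).mul ?_
  exact (tendsto_finsetProd _ fun lam' _ => tendsto_Rt hr hdr hp lam').mul
    (tendsto_finsetProd _ fun lam' _ => tendsto_cfac hr hp lam')

/-- `Π_{λ∉{μ,ν}} Y^{(n)}_λ(p) → Π_{λ∉{μ,ν}} Y_∞(λ; p)`. [folklore] -/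
theorem tendsto_prodYc (μ ν : Fin d) :
    Tendsto (fun j : ℕ => ∏ lam ∈ (univ.erase μ).erase ν, Yc (j + 1) lam p) atTop
      (𝓝 (∏ lam ∈ (univ.erase μ).erase ν, YcInf lam p)) :=
  tendsto_finsetProd _ fun lam _ => tendsto_Yc hr hdr hp lam

end Assembly

section Strip

variable {κ : ℝ} (hκ0 : 0 ≤ κ) (hκ : κ ≤ kappa166 d) {p : Fin d → ℂ} (hp : p ∈ Strip d κ)
include hκ0 hκ hp

/-- on the zero-free strip the continuum denominator is non-zero: `‖F_∞(p)‖ ≥ ((4/π²)^d)^d/2` (limit of `F66_lower`). [folklore] -/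
theorem norm_F66Inf_ge : ((4 / Real.pi ^ 2) ^ d) ^ d / 2 ≤ ‖F66Inf p‖ := by
  have hfat : p ∈ Fat d (rOf d) := strip_subset_fat (rOf_pos d).le (hκ.trans (kappa166_le_rOf d)) hp
  have ht := (tendsto_F66 (rOf_le d) (d_mul_rOf_sq_le d) hfat).norm
  exact ge_of_tendsto ht (Eventually.of_forall fun j => F66_lower (j + 1) hκ0 hκ p hp)

/-- `F_∞(p) ≠ 0` on the zero-free strip. [folklore] -/
theorem F66Inf_ne_zero : F66Inf p ≠ 0 := by
  intro h
  have := norm_F66Inf_ge hκ0 hκ hp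
  rw [h, norm_zero] at this
  have : (0 : ℝ) < ((4 / Real.pi ^ 2) ^ d) ^ d / 2 := by positivity
  linarith

/-- **`W^{(n)}_{μν}(p) → W_∞(μ,ν; p)` on the zero-free strip.** [folklore] -/
theorem tendsto_W166 (μ ν : Fin d) : Tendsto (fun j : ℕ => W166 (j + 1) μ ν p) atTop (𝓝 (W166Inf μ ν p)) := by
  have hfat : p ∈ Fat d (rOf d) := strip_subset_fat (rOf_pos d).le (hκ.trans (kappa166_le_rOf d)) hp
  unfold W166 W166Inf
  exact (tendsto_prodYc (rOf_le d) (d_mul_rOf_sq_le d) hfat μ ν).div (tendsto_F66 (rOf_le d) (d_mul_rOf_sq_le d) hfat)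
    (F66Inf_ne_zero hκ0 hκ hp)

/-- **THE CONTINUUM (1.66) MULTIPLIER IN CLOSED FORM**: on the zero-free strip `Strip d κ` (`0 ≤ κ ≤ κ₁₆₆(d)`; `κ = 0` = the real Brillouin zone),
t4-ne2's constructed limit `W166lim μ ν p` (`limUnder`, King's rate) EQUALS the explicit alias-series expression `W166Inf μ ν p`.  Hence gan24-p3's
`GsymLim` / `deltaZLim` (the perfect Laplacian `Δ_∞`) and, through `FP/PerfectSymbolKMultiplier`, the multiplier block of road FP's perfect resolvent
`KPerf … m` have a CLOSED-FORM symbol. [our object] (uniqueness of limits). -/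
theorem W166lim_eq_W166Inf (μ ν : Fin d) : W166lim μ ν p = W166Inf μ ν p :=
  tendsto_nhds_unique (tendsto_W166lim hκ0 hκ hp μ ν) (tendsto_W166 hκ0 hκ hp μ ν)

end Strip

/-! ## §5 Canonical normalisation at zero momentum: `W_∞(μ,ν; 0) = 1` -/

/-- `u_∞(0; 0) = 1`, `U_∞(0; 0) = 1`, `c_∞(λ; 0) = 1`. [folklore] -/
theorem cfacInf_zero (lam : Fin d) : cfacInf lam (0 : Fin d → ℂ) = 1 := by
  have hu : uInf 0 (0 : ℂ) = 1 := by simp [uInf]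
  unfold cfacInf UInf
  simp [hu]

/-- `Y_∞(λ; 0) = 1` (the alias remainder is multiplied by `Σ_ν p_ν² = 0`). [folklore] -/
theorem YcInf_zero (lam : Fin d) : YcInf lam (0 : Fin d → ℂ) = 1 := by
  unfold YcInf D0Inf
  simp [cfacInf_zero]

/-- `F_∞(0) = 1` (`S₁(0) = 0` kills every alias monomial; `U_∞(0;0)^d = 1`). [folklore] -/
theorem F66Inf_zero : F66Inf (0 : Fin d → ℂ) = 1 := by
  have hu : uInf 0 (0 : ℂ) = 1 := by simp [uInf]
  have hU : UInf 0 (0 : Fin d → ℂ) = 1 := by unfold UInf; simp [hu]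
  have hS : S1 (0 : ℂ) = 0 := by simp [S1]
  unfold F66Inf
  simp [hU, hS]

/-- **THE PERFECT QUADRATIC FORM IS CANONICALLY NORMALISED**: `W_∞(μ,ν; 0) = 1` — at zero momentum the continuum (1.66) field-strength weight is exactly `1`
(no tree-level wave-function factor after infinitely many averaging steps). [our object] -/
theorem W166Inf_zero (μ ν : Fin d) : W166Inf μ ν (0 : Fin d → ℂ) = 1 := by
  unfold W166Inf
  simp [YcInf_zero, F66Inf_zero]

/-- the same for t4-ne2's constructed limit: `W166lim μ ν 0 = 1` (`0` lies in every strip). [our object] -/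
theorem W166lim_zero (μ ν : Fin d) : W166lim μ ν (0 : Fin d → ℂ) = 1 := by
  have h0 : (0 : Fin d → ℂ) ∈ Strip d 0 := fun _ => by simp [Real.pi_pos.le]
  rw [W166lim_eq_W166Inf le_rfl (B5Symbol166Strip.kappa166_pos d).le h0, W166Inf_zero]

end Summit.QuantumFields.BalabanUV.Beta.FP.PerfectSymbol166

end
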